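import Summits.NavierStokesRegularity.NavierStokesRegularity.Theorems.Target.Negative.EnergyClassLoadBearing
import Literature.Analysis.FluidPDE.ClassicalSuitable
import Literature.Analysis.FluidPDE.AxisymmetricTypeIAxis
import Literature.Barriers.NavierStokesRegularity.AxisymmetricTypeIExclusion

/-!
# Crux `Target` = `TypeICertificateLadder.NoTypeIBlowup` (stmt-NavierStokesRegularity-1217), negative side:
# in the provers' local reduction the pressure class `π ∈ L^{3/2}(Q)` is load-bearing

Negative-side (cdisprove, D-0016) support lemmas extracted from the crux work file
`Cruxes/Target/Disproof.lean` §3 (gen 2), importable. The provers' landed reduction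
`Theorems.noTypeIBlowup_of_local_typeI_regularity` derives the crux from the LOCAL statement
`LocalTypeIRegularity` below (Seregin–Šverák 2009, Thm. 3.1 with the axial symmetry deleted —
OPEN): a distributional solution `(v, π)` in the Seregin–Šverák cylinder `Q = 𝒞 × ]-1, 0[` with
`v ∈ L³(Q)`, `π ∈ L^{3/2}(Q)` and the a.e. Type-I rate `√(-s)|v| ≤ C` is essentially bounded near
the vertex.

* `localTypeIRegularity_false_without_pressure` — deleting ONLY the clause `π ∈ L^{3/2}(Q)` makes
  the local statement FALSE: the drift flow in the local variables, `v(s, y) = -log(-s) e₀`,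
  `π(s, y) = -⟪a'(s) e₀, y⟫` (the uniform family `isClassicalNSSolutionOn_uniform` of
  `EnergyClassLoadBearing`), is distributional in `Q`, lies in `L³(Q)`, has the a.e. rate with
  constant `2`, and is essentially unbounded on every `Q_r(0, 0)`. So any proof of the local
  statement must use the pressure integrability (equivalently the local energy it buys,
  Seregin–Šverák 2009, Lemma 3.5). [cite: SereginSverak2009, Thm. 3.1 and Lemma 3.5]

Nothing here closes the item (`--supports`).
-/

noncomputable section

open MeasureTheory TopologicalSpace Set Function Filter Metric
open scoped Topology RealInnerProductSpace ContDiff Laplacian InnerProductSpace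
open Literature.Analysis.FluidPDE Literature.Barriers.NavierStokesRegularity

namespace Summit.NavierStokesRegularity.NavierStokesRegularity.Theorems.Target.Negative

/-- Local notation for physical space `ℝ³ = EuclideanSpace ℝ (Fin 3)`. -/
local notation "ℝ³" => EuclideanSpace ℝ (Fin 3)

/-! ## §3 The local reduction: pressure integrability is load-bearing -/

section Local

/-- The provers' local hypothesis `hloc` of
`Theorems.noTypeIBlowup_of_local_typeI_regularity` (Seregin–Šverák 2009, Thm 3.1 with the
axial symmetry deleted; OPEN), verbatim. -/
def LocalTypeIRegularity : Prop :=
  ∀ (v : ℝ → ℝ³ → ℝ³) (π : ℝ → ℝ³ → ℝ),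
    IsDistributionalNSSolutionOn ssCylinderOpens 1 0 v π →
    (∫⁻ z in ssCylinder, ‖v z.1 z.2‖ₑ ^ (3 : ℕ) < ⊤) →
    (∫⁻ z in ssCylinder, ‖π z.1 z.2‖ₑ ^ (3 / 2 : ℝ) < ⊤) →
    (∃ C : ℝ, ∀ᵐ z ∂(volume.restrict ssCylinder), Real.sqrt (-z.1) * ‖v z.1 z.2‖ ≤ C) →
    ∃ r > 0, eLpNorm (uncurry v) ⊤
      (volume.restrict (parabolicCylinder r ((0 : ℝ), (0 : ℝ³)))) < ⊤

/-- `LocalTypeIRegularity` with the pressure clause `π ∈ L^{3/2}(Q)` DELETED. -/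
def LocalTypeIRegularityWithoutPressure : Prop :=
  ∀ (v : ℝ → ℝ³ → ℝ³) (π : ℝ → ℝ³ → ℝ),
    IsDistributionalNSSolutionOn ssCylinderOpens 1 0 v π →
    (∫⁻ z in ssCylinder, ‖v z.1 z.2‖ₑ ^ (3 : ℕ) < ⊤) →
    (∃ C : ℝ, ∀ᵐ z ∂(volume.restrict ssCylinder), Real.sqrt (-z.1) * ‖v z.1 z.2‖ ≤ C) →
    ∃ r > 0, eLpNorm (uncurry v) ⊤
      (volume.restrict (parabolicCylinder r ((0 : ℝ), (0 : ℝ³)))) < ⊤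

/-- The local drift amplitude `a(s) = -log(-s)` (the drift flow in the time variable `s = t - 1`). -/
def localAmp (s : ℝ) : ℝ := -Real.log (-s)

/-- The local drift flow `v(s, y) = -log(-s) e₀`. -/
def localVel : ℝ → ℝ³ → ℝ³ := uniformVel localAmp e₀

/-- Its pressure `π(s, y) = ⟪-a'(s) e₀, y⟫ = -y₀ / (-s)` on `s < 0` — NOT in `L^{3/2}(Q)`
(`∫_{-1}^0 (-s)^{-3/2} ds = ∞`), consistently with `LocalTypeIRegularity`. -/
def localPres : ℝ → ℝ³ → ℝ := uniformPres (derivWithin localAmp (Ioo (-1) 0)) e₀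

/-- The local drift amplitude is smooth on `(-1, 0)`. -/
theorem contDiffOn_localAmp : ContDiffOn ℝ ∞ localAmp (Ioo (-1) 0) := by
  have h1 : ContDiffOn ℝ ∞ (fun s : ℝ => -s) (Ioo (-1) 0) := contDiff_neg.contDiffOn
  have h2 : MapsTo (fun s : ℝ => -s) (Ioo (-1 : ℝ) 0) ({0}ᶜ) := fun s hs => by
    simp only [mem_compl_iff, mem_singleton_iff, neg_eq_zero]
    exact hs.2.ne
  exact (Real.contDiffOn_log.comp h1 h2).neg

/-- The local drift flow is classical on the open time interval `(-1, 0)` (viscosity `1`). -/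
theorem isClassical_local : IsClassicalNSSolutionOn (Ioo (-1) 0) 1 0 localVel localPres :=
  isClassicalNSSolutionOn_uniform (uniqueDiffOn_Ioo (-1) 0) contDiffOn_localAmp 1 e₀

/-- … hence a distributional solution in the Seregin–Šverák cylinder `Q = 𝒞 × ]-1, 0[`. -/
theorem isDistributional_local : IsDistributionalNSSolutionOn ssCylinderOpens 1 0 localVel localPres := by
  have hcl := isClassical_local
  have hQ : ((ssCylinderOpens : Opens (ℝ × ℝ³)) : Set (ℝ × ℝ³)) ⊆ Ioo (-1) 0 ×ˢ univ := by
    intro z hz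
    exact mk_mem_prod (mem_ssCylinder.1 hz).1 (mem_univ _)
  refine isDistributionalNSSolutionOn_of_contDiffOn isOpen_Ioo hQ
    (hcl.smooth_velocity.of_le (by norm_cast)) (hcl.smooth_pressure.of_le (by norm_cast))
    continuousOn_const (fun t ht x => ?_) hcl.divFree
  have hm := hcl.momentum t ht x
  rwa [timeDerivWithin_eq_deriv isOpen_Ioo ht, ← timeDeriv_apply] at hm

/-- Pointwise size of the local drift flow: `‖v(s, y)‖ = -log(-s)` for `-1 < s < 0`. -/
theorem norm_localVel {s : ℝ} (hs : s ∈ Ioo (-1 : ℝ) 0) (y : ℝ³) :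
    ‖localVel s y‖ = -Real.log (-s) := by
  have hy : 0 < -s := neg_pos.2 hs.2
  have hle : -s ≤ 1 := by linarith [hs.1]
  have hlog : Real.log s ≤ 0 := by
    rw [← Real.log_neg_eq_log]
    exact Real.log_nonpos hy.le hle
  simp [localVel, localAmp, norm_smul, abs_of_nonpos hlog, Real.log_neg_eq_log]

/-- The local drift flow has the a.e. Type-I rate on `Q` with constant `2`. -/
theorem localVel_typeI :
    ∃ C : ℝ, ∀ᵐ z ∂(volume.restrict ssCylinder), Real.sqrt (-z.1) * ‖localVel z.1 z.2‖ ≤ C := by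
  refine ⟨2, (ae_restrict_iff' isOpen_ssCylinder.measurableSet).2 (ae_of_all _ fun z hz => ?_)⟩
  have hs := (mem_ssCylinder.1 hz).1
  rw [norm_localVel hs]
  exact sqrt_mul_neg_log_le_two (neg_pos.2 hs.2)

/-- `(-log y)³ ≤ 64 y^{-3/4}` on `0 < y ≤ 1` (cube of `-log y ≤ 4 y^{-1/4}`). -/
theorem neg_log_pow_three_le {y : ℝ} (hy : 0 < y) (hy1 : y ≤ 1) :
    (-Real.log y) ^ 3 ≤ 64 * y ^ (-(3 / 4 : ℝ)) := by
  have h := neg_log_le_rpow_div hy (by norm_num : (0 : ℝ) < 1 / 4)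
  have h0 : 0 ≤ -Real.log y := by
    have := Real.log_nonpos hy.le hy1
    linarith
  have h4 : -Real.log y ≤ 4 * y ^ (-(1 / 4 : ℝ)) := by
    calc -Real.log y ≤ y ^ (-(1 / 4 : ℝ)) / (1 / 4) := h
      _ = 4 * y ^ (-(1 / 4 : ℝ)) := by ring
  have hpow : (y ^ (-(1 / 4 : ℝ))) ^ 3 = y ^ (-(3 / 4 : ℝ)) := by
    rw [← Real.rpow_natCast, ← Real.rpow_mul hy.le]
    norm_num
  calc (-Real.log y) ^ 3 ≤ (4 * y ^ (-(1 / 4 : ℝ))) ^ 3 := by gcongr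
    _ = 64 * y ^ (-(3 / 4 : ℝ)) := by rw [mul_pow, hpow]; norm_num

/-- The majorant `s ↦ 64 (0 - s)^{-3/4}` is integrable on `(-1, 0)`. -/
theorem integrableOn_majorant :
    IntegrableOn (fun s : ℝ => 64 * (0 - s) ^ (-(3 / 4 : ℝ))) (Ioo (-1) 0) := by
  have hint : IntervalIntegrable (fun x : ℝ => x ^ (-(3 / 4 : ℝ))) volume 0 1 :=
    intervalIntegral.intervalIntegrable_rpow' (by norm_num)
  have hint2 : IntervalIntegrable (fun x : ℝ => (0 - x) ^ (-(3 / 4 : ℝ))) volume (0 - 0) (0 - 1) :=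
    hint.comp_sub_left 0
  rw [sub_zero, zero_sub] at hint2
  have hint3 : IntegrableOn (fun x : ℝ => (0 - x) ^ (-(3 / 4 : ℝ))) (Ioo (-1) 0) :=
    (intervalIntegrable_iff_integrableOn_Ioo_of_le (by norm_num)).1 hint2.symm
  exact hint3.const_mul 64

/-- The local drift flow lies in `L³(Q)`. -/
theorem lintegral_localVel_cube_lt_top :
    ∫⁻ z in ssCylinder, ‖localVel z.1 z.2‖ₑ ^ (3 : ℕ) < ⊤ := by
  set G : ℝ → ENNReal := fun s => ENNReal.ofReal (64 * (0 - s) ^ (-(3 / 4 : ℝ))) with hG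
  have hGm : Measurable G := by
    refine ENNReal.measurable_ofReal.comp ?_
    exact measurable_const.mul ((measurable_const.sub measurable_id).pow_const _)
  -- pointwise majorant on `Q`
  have hbound : ∀ z ∈ ssCylinder, ‖localVel z.1 z.2‖ₑ ^ (3 : ℕ) ≤ G z.1 := by
    intro z hz
    have hs := (mem_ssCylinder.1 hz).1
    have hy : 0 < -z.1 := neg_pos.2 hs.2
    have hy1 : -z.1 ≤ 1 := by linarith [hs.1]
    rw [← ofReal_norm, ← ENNReal.ofReal_pow (norm_nonneg _), norm_localVel hs, hG]
    simp only [zero_sub]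
    exact ENNReal.ofReal_le_ofReal (neg_log_pow_three_le hy hy1)
  -- `Q ⊆ (-1, 0) × B(0, 2)`
  have hsub : ssCylinder ⊆ Ioo (-1 : ℝ) 0 ×ˢ ball (0 : ℝ³) 2 := fun z hz =>
    mk_mem_prod (mem_ssCylinder.1 hz).1 (mem_ball_zero_iff.2 (norm_lt_two_of_mem_ssCylinder hz))
  have h1 : ∫⁻ z in ssCylinder, ‖localVel z.1 z.2‖ₑ ^ (3 : ℕ) ≤ ∫⁻ z in ssCylinder, G z.1 :=
    setLIntegral_mono' isOpen_ssCylinder.measurableSet fun z hz => hbound z hz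
  have h2 : ∫⁻ z in ssCylinder, G z.1 ≤ ∫⁻ z in Ioo (-1 : ℝ) 0 ×ˢ ball (0 : ℝ³) 2, G z.1 :=
    lintegral_mono_set hsub
  have h3 : ∫⁻ z in Ioo (-1 : ℝ) 0 ×ˢ ball (0 : ℝ³) 2, G z.1 =
      (∫⁻ s in Ioo (-1 : ℝ) 0, G s) * volume (ball (0 : ℝ³) 2) := by
    rw [Measure.volume_eq_prod, ← Measure.prod_restrict,
      lintegral_prod (fun z : ℝ × ℝ³ => G z.1) (hGm.comp measurable_fst).aemeasurable]
    simp only [lintegral_const, Measure.restrict_apply_univ]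
    rw [lintegral_mul_const _ hGm]
  have h4 : ∫⁻ s in Ioo (-1 : ℝ) 0, G s < ⊤ := integrableOn_majorant.setLIntegral_lt_top
  have h5 : volume (ball (0 : ℝ³) 2) < ⊤ := measure_ball_lt_top
  calc ∫⁻ z in ssCylinder, ‖localVel z.1 z.2‖ₑ ^ (3 : ℕ)
      ≤ (∫⁻ s in Ioo (-1 : ℝ) 0, G s) * volume (ball (0 : ℝ³) 2) := (h1.trans h2).trans h3.le
    _ < ⊤ := ENNReal.mul_lt_top h4 h5

/-- **The local drift flow is essentially unbounded on every backward cylinder about the vertex.** -/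
theorem localVel_not_bounded_near_vertex :
    ¬ ∃ r > 0, eLpNorm (uncurry localVel) ⊤
      (volume.restrict (parabolicCylinder r ((0 : ℝ), (0 : ℝ³)))) < ⊤ := by
  rintro ⟨r, hr, hfin⟩
  set μr := (volume : Measure (ℝ × ℝ³)).restrict (parabolicCylinder r ((0 : ℝ), (0 : ℝ³))) with hμr
  rw [eLpNorm_exponent_top] at hfin
  set S := eLpNormEssSup (uncurry localVel) μr with hSdef
  have hae : ∀ᵐ z ∂μr, ‖uncurry localVel z‖ₑ ≤ S := enorm_ae_le_eLpNormEssSup _ _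
  set M : ℝ := S.toReal with hM
  have hSM : S = ENNReal.ofReal M := (ENNReal.ofReal_toReal hfin.ne).symm
  have hM0 : 0 ≤ M := ENNReal.toReal_nonneg
  -- the bad set `U = (-ε, 0) × B(0, r)` on which `‖v‖ > M + 1`
  set ε : ℝ := min (r ^ 2) (Real.exp (-(M + 1))) with hε
  have hεpos : 0 < ε := lt_min (by positivity) (Real.exp_pos _)
  set U : Set (ℝ × ℝ³) := Ioo (-ε) 0 ×ˢ ball (0 : ℝ³) r with hU
  have hUsub : U ⊆ parabolicCylinder r ((0 : ℝ), (0 : ℝ³)) := by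
    rintro ⟨s, y⟩ ⟨hs, hy⟩
    refine mk_mem_prod ⟨?_, hs.2⟩ hy
    have : ε ≤ r ^ 2 := min_le_left _ _
    show (0 : ℝ) - r ^ 2 < s
    linarith [hs.1]
  have hUmeas : MeasurableSet U := measurableSet_Ioo.prod measurableSet_ball
  have hbig : ∀ z ∈ U, S < ‖uncurry localVel z‖ₑ := by
    rintro ⟨s, y⟩ ⟨hs, -⟩
    have hspos : 0 < -s := neg_pos.2 hs.2
    have hεe : ε ≤ Real.exp (-(M + 1)) := min_le_right _ _
    have hε1 : ε ≤ 1 := hεe.trans (Real.exp_le_one_iff.2 (by linarith))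
    have hs' : s ∈ Ioo (-1 : ℝ) 0 := ⟨by linarith [hs.1], hs.2⟩
    have hlt : -s < Real.exp (-(M + 1)) := by linarith [hs.1]
    have hlog : Real.log (-s) < -(M + 1) := by
      have := Real.log_lt_log hspos hlt
      rwa [Real.log_exp] at this
    have hval : ‖uncurry localVel (s, y)‖ = -Real.log (-s) := norm_localVel hs' y
    rw [hSM, ← ofReal_norm, hval]
    exact (ENNReal.ofReal_lt_ofReal_iff (by linarith)).2 (by linarith)
  have h1 : ∀ᵐ z ∂(volume.restrict U), ‖uncurry localVel z‖ₑ ≤ S :=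
    ae_restrict_of_ae_restrict_of_subset hUsub hae
  have h2 : ∀ᵐ z ∂(volume.restrict U), S < ‖uncurry localVel z‖ₑ :=
    (ae_restrict_iff' hUmeas).2 (ae_of_all _ hbig)
  have h3 : ∀ᵐ z ∂(volume.restrict U), False := by
    filter_upwards [h1, h2] with z h1 h2 using absurd h1 (not_le.2 h2)
  have hzero : (volume : Measure (ℝ × ℝ³)).restrict U = 0 := by
    rwa [Filter.eventually_false_iff_eq_bot, ae_eq_bot] at h3
  have hUpos : 0 < (volume : Measure (ℝ × ℝ³)) U := by
    rw [hU, Measure.volume_eq_prod, Measure.prod_prod]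
    refine ENNReal.mul_pos ?_ (measure_ball_pos volume (0 : ℝ³) hr).ne'
    rw [Real.volume_Ioo]
    simp [hεpos]
  rw [Measure.restrict_eq_zero] at hzero
  exact hUpos.ne' hzero

/-- **Any proof of the local statement must use the pressure integrability `π ∈ L^{3/2}(Q)`**:
with that clause deleted the statement is false (local drift flow). Equivalently: the local Type-I
class `L³(Q)` + a.e. rate + distributional does NOT control the local energy, and Serrin-type
parasitic solutions live in it. -/
theorem localTypeIRegularity_false_without_pressure : ¬ LocalTypeIRegularityWithoutPressure :=
  fun h => localVel_not_bounded_near_vertex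
    (h localVel localPres isDistributional_local lintegral_localVel_cube_lt_top localVel_typeI)

end Local

end Summit.NavierStokesRegularity.NavierStokesRegularity.Theorems.Target.Negative

end
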